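import Literature.NumberTheory.Automorphic.Liu2021.Def411WeilCarriersLocalTypesOfEquiv
import Literature.RepresentationTheory.Semisimple.SemilinearIsotypicRestriction
import HarnessLib

/-!
# [Liu2021, Thm. 4.18 (3)]: a `σ`-SEMILINEAR isomorphism of two carriers `ω(μ, ε, χ)` restricts, at every finite place, to a
# `σ`-semilinear isomorphism of the LOCAL TYPES — the restriction step of the Galois-twist argument, for the tree's constructed
# carriers `rhoAtLine`

Topic `NumberTheory/Automorphic/Liu2021`; namespace `Literature.NumberTheory.Automorphic.Liu2021.Def411WeilCarriers`.  KERNEL ONLY: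
theorems (no definition, no named fact, no `sorry`).  The `σ`-semilinear edition of ✔ `Def411WeilCarriersLocalTypesOfEquiv.lean`
(`nonempty_equiv_localTypes_of_equivId_of_isIrreducible`, `…_of_equivId`, `…_of_equiv`), with ✔
`Literature.RepresentationTheory.Semisimple.exists_semilinear_equivariant_bijective_of_isotypicComponent_eq_top` (the semilinear Flath
uniqueness clause) in place of the linear one.

WHY ([Liu2021, Thm. 4.18 (3)], l. 2243, proof l. 2272–2289; cell hodgecm-mathlib row III-11 `Thm418Data.EpsRigidUnderGaloisTwist`, road memo
`A-provers/A-p19/ROAD-III11-v2.md`, piece P2).  Item (3) — «for every `μ`-admissible `ε` the subspace `⊕_χ ω(μ,ε,χ)` is stable under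
`Gal(ℂ/M_μ)`» — is, at dictionary level, the RIGIDITY of `ε` under `σ`-semilinear `𝔾(𝔸_F^∞)`-isomorphisms `ω(μ,ε,χ) → ω(μ,ε',χ')`,
`σ ∈ Aut(ℂ/M_μ)`.  Exactly as for item (2) («Statement (2) follows from Lemma D.1», l. 2270), the first step is LOCAL: such an isomorphism
restricts, at every finite place `v`, to a `σ`-semilinear `U(J_V)(F_v)`-equivariant bijection between the local types
`X_v(𝓢, a, χ) → X_v(𝓢', a', χ')` (Def. 4.11: `ω(μ,ε,χ) = ⊗'_v ω(μ_v,ε_v,χ_v)`; both restrictions are ISOTYPIC of their local types — ✔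
`isotypicComponent_rhoAtLine_comp_eq_top_of_factors` — and the local types are irreducible by Lemma D.1 (1) AS PRINTED, ✔
`isIrreducible_localType_of_lemD1AsPrinted`).  This file proves that step for an arbitrary ring endomorphism `τ : ℂ →+* ℂ` with
`RingHomSurjective τ` (every `σ ∈ Aut(ℂ/M_μ)` qualifies):

* `exists_semilinear_localTypes_of_semilinearId_of_isIrreducible` — irreducibility of the two local types GIVEN (instances);
* `exists_semilinear_localTypes_of_semilinearId` — irreducibility from Lem. D.1 (1) AS PRINTED at both pair data (`hD1`, `hD1'`);
* `exists_semilinear_localTypes_of_semilinear` — consumer form: any `ι : G →* U(J_V)(𝔸_f)` ONTO (at the COR-CM face: `ιVE V`), the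
  hypothesis being verbatim the shape of row III-11 (`∃ f : ω →ₛₗ[τ] ω', Bijective f ∧ ∀ g x, f (ρ g x) = ρ' g (f x)`).

HC_CM is NOT proved and not mentioned further; nothing about the Galois twist of the local Weil representation (road piece P3) is claimed here.

## References
* [Liu2021] Y. Liu, Camb. J. Math. 9 (2021) = arXiv:2102.11518: Def. 4.11 (l. 2083–2097), Thm. 4.18 (3) (l. 2243) with proof (l. 2272–2289),
  Thm. 4.18 (2) proof sentence l. 2270, App. D Lem. D.1 (1) (l. 5229).
* [FlathCorvallis1979] D. Flath, PSPM 33.1 (1979), Theorem 3 (uniqueness clause).  [Bump1997] D. Bump, CUP 1997, §3.4 Prop. 3.4.1.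
-/

set_option autoImplicit false

noncomputable section

open scoped Matrix Kronecker RestrictedProduct NumberField Classical
open NumberField IsDedekindDomain Filter Set
open Literature.NumberTheory Literature.NumberTheory.Automorphic Literature.NumberTheory.Automorphic.UnitaryGroup
open Literature.NumberTheory.GelbartRogawski1991 Literature.NumberTheory.GelbartRogawski1991.UnitaryDualPair
open Literature.NumberTheory.GelbartRogawski1991.UnitaryDualPair.WeilCoinv
open Literature.NumberTheory.Weil1964 Literature.RepresentationTheory

namespace Literature.NumberTheory.Automorphic.Liu2021.Def411WeilCarriers

variable (F E : Type) [Field F] [NumberField F] [Field E] [NumberField E] [Algebra F E]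
variable (c : E ≃ₐ[F] E) (N : ℕ) {n : ℕ} (e : Fin N × Fin 1 ≃ Fin n)
variable (JV : Matrix (Fin N) (Fin N) E) {TV : Matrix (Fin N) (Fin N) F}
variable [Algebra.IsQuadraticExtension F E] {δ : E} (hcδ : c δ = -δ) (hδ : δ ≠ 0) {d : F} (hd : δ * δ = algebraMap F E d)
variable {τ : ℂ →+* ℂ}

/-! ## §1 A `G`-equivariant semilinear bijection of two carriers, for `ι` onto, is `U(J_V)(𝔸_f)`-equivariant -/

/-- **Bookkeeping**: for `ι : G →* U(J_V)(𝔸_f)` ONTO, a `G`-equivariant `τ`-semilinear bijection between the carriers `rhoAtLine … hs ι a χ`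
and `rhoAtLine … hs' ι a' χ'` is a `U(J_V)(𝔸_f)`-equivariant one between the carriers read through `MonoidHom.id`
(`rhoAtLine … ι a χ g = rhoVAtLine … a χ (ι g)`). [cite: Liu2021, Def. 4.11 (l. 2092–2096), App. C (l. 4624)] -/
theorem exists_semilinearId_of_semilinear (hV : TV.IsSymm) (hVd : IsUnit TV.det)
    (hJV : JV = TV.map (algebraMap F E))
    {s : ∀ a : Fˣ, UnitaryGroup.adelicPair F E c N 1 JV (JW F E a) →* adelicMpCont F (Fin n) (adelicGram F e TV (TW F a))}
    (hs : ∀ a : Fˣ, (splittingDatum F E c N 1 e JV (JW F E a) hcδ hδ hd hV (isSymm_TW F a) hVd (isUnit_det_TW F a) hJV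
      (JW_eq F E a)).IsCompatible (s a))
    {s' : ∀ a : Fˣ, UnitaryGroup.adelicPair F E c N 1 JV (JW F E a) →* adelicMpCont F (Fin n) (adelicGram F e TV (TW F a))}
    (hs' : ∀ a : Fˣ, (splittingDatum F E c N 1 e JV (JW F E a) hcδ hδ hd hV (isSymm_TW F a) hVd (isUnit_det_TW F a) hJV
      (JW_eq F E a)).IsCompatible (s' a))
    (a a' : Fˣ) (χ χ' : Chi F E c) {G : Type*} [Group G] {ι : G →* UnitaryGroup.finAdelic F E c N JV} (hι : Function.Surjective ι)
    (hst : ∃ f : omegaAtLine F E c N e JV hcδ hδ hd hV hVd hJV hs a χ →ₛₗ[τ] omegaAtLine F E c N e JV hcδ hδ hd hV hVd hJV hs' a' χ',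
      Function.Bijective f ∧ ∀ (g : G) (x : omegaAtLine F E c N e JV hcδ hδ hd hV hVd hJV hs a χ),
        f (rhoAtLine F E c N e JV hcδ hδ hd hV hVd hJV hs ι a χ g x) = rhoAtLine F E c N e JV hcδ hδ hd hV hVd hJV hs' ι a' χ' g (f x)) :
    ∃ f : omegaAtLine F E c N e JV hcδ hδ hd hV hVd hJV hs a χ →ₛₗ[τ] omegaAtLine F E c N e JV hcδ hδ hd hV hVd hJV hs' a' χ',
      Function.Bijective f ∧ ∀ (g : UnitaryGroup.finAdelic F E c N JV) (x : omegaAtLine F E c N e JV hcδ hδ hd hV hVd hJV hs a χ),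
        f (rhoAtLine F E c N e JV hcδ hδ hd hV hVd hJV hs (MonoidHom.id _) a χ g x) =
          rhoAtLine F E c N e JV hcδ hδ hd hV hVd hJV hs' (MonoidHom.id _) a' χ' g (f x) := by
  obtain ⟨f, hf, hfe⟩ := hst
  refine ⟨f, hf, fun g' x => ?_⟩
  obtain ⟨g, rfl⟩ := hι g'
  exact hfe g x

/-! ## §2 THE RESTRICTION STEP under a semilinear isomorphism -/

/-- **THE RESTRICTION STEP of the Galois-twist argument for [Liu2021, Thm. 4.18 (3)], the irreducibility of the local types GIVEN**: a
`τ`-semilinear `U(J_V)(𝔸_f)`-equivariant bijection `rhoAtLine … hs id a χ → rhoAtLine … hs' id a' χ'` of a NON-ZERO carrier yields, at every finite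
place `v` (coordinate embedding `inclPlace v`; both restrictions ISOTYPIC of their local types by ✔ `isotypicComponent_rhoAtLine_comp_eq_top_of_factors`),
a `τ`-semilinear `U(J_V)(F_v)`-equivariant BIJECTION of the local types `X_v(𝓢, a, χ) → X_v(𝓢', a', χ')` — ✔
`Semisimple.exists_semilinear_equivariant_bijective_of_isotypicComponent_eq_top'` (semilinear Flath uniqueness clause).
[cite: Liu2021, Def. 4.11 (l. 2092–2096), Thm. 4.18 (3) with proof l. 2272–2289; FlathCorvallis1979, Theorem 3 (uniqueness clause); Bump1997, §3.4 Prop. 3.4.1] -/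
theorem exists_semilinear_localTypes_of_semilinearId_of_isIrreducible [RingHomSurjective τ] (hV : TV.IsSymm) (hVd : IsUnit TV.det)
    (hJV : JV = TV.map (algebraMap F E))
    {s : ∀ a : Fˣ, UnitaryGroup.adelicPair F E c N 1 JV (JW F E a) →* adelicMpCont F (Fin n) (adelicGram F e TV (TW F a))}
    (hs : ∀ a : Fˣ, (splittingDatum F E c N 1 e JV (JW F E a) hcδ hδ hd hV (isSymm_TW F a) hVd (isUnit_det_TW F a) hJV
      (JW_eq F E a)).IsCompatible (s a))
    {s' : ∀ a : Fˣ, UnitaryGroup.adelicPair F E c N 1 JV (JW F E a) →* adelicMpCont F (Fin n) (adelicGram F e TV (TW F a))}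
    (hs' : ∀ a : Fˣ, (splittingDatum F E c N 1 e JV (JW F E a) hcδ hδ hd hV (isSymm_TW F a) hVd (isUnit_det_TW F a) hJV
      (JW_eq F E a)).IsCompatible (s' a))
    (a : Fˣ) (χ : Chi F E c)
    (𝓢 : LocalSplitting.FinLocalSplittings F E c n hcδ hδ hd (gram F e TV (TW F a)) (isSymm_gram F e hV (isSymm_TW F a))
      (reindex_kronecker_eq_gram_map F E e hJV (JW_eq F E a)))
    (a' : Fˣ) (χ' : Chi F E c)
    (𝓢' : LocalSplitting.FinLocalSplittings F E c n hcδ hδ hd (gram F e TV (TW F a')) (isSymm_gram F e hV (isSymm_TW F a'))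
      (reindex_kronecker_eq_gram_map F E e hJV (JW_eq F E a')))
    (hfac : (pairSmall₁ F E c N 1 e JV (JW F E a) (s a)).comp (finPairToAdelic F E c N 1 JV (JW F E a)) =
      localRefSection F E c N 1 e JV (JW F E a) hcδ hδ hd hV (isSymm_TW F a) hJV (JW_eq F E a) 𝓢)
    (hfac' : (pairSmall₁ F E c N 1 e JV (JW F E a') (s' a')).comp (finPairToAdelic F E c N 1 JV (JW F E a')) =
      localRefSection F E c N 1 e JV (JW F E a') hcδ hδ hd hV (isSymm_TW F a') hJV (JW_eq F E a') 𝓢')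
    (hn : 3 ≤ n)
    [Nontrivial (omegaAtLine F E c N e JV hcδ hδ hd hV hVd hJV hs a χ)]
    (hst : ∃ f : omegaAtLine F E c N e JV hcδ hδ hd hV hVd hJV hs a χ →ₛₗ[τ] omegaAtLine F E c N e JV hcδ hδ hd hV hVd hJV hs' a' χ',
      Function.Bijective f ∧ ∀ (g : UnitaryGroup.finAdelic F E c N JV) (x : omegaAtLine F E c N e JV hcδ hδ hd hV hVd hJV hs a χ),
        f (rhoAtLine F E c N e JV hcδ hδ hd hV hVd hJV hs (MonoidHom.id _) a χ g x) =
          rhoAtLine F E c N e JV hcδ hδ hd hV hVd hJV hs' (MonoidHom.id _) a' χ' g (f x))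
    (v : HeightOneSpectrum (𝓞 F))
    [hX : (show Representation ℂ (UnitaryGroup.localPi E c N JV v) _ from
        (TwistedCoinv.rep (localCharOfCenter F E c (JW F E a) (JW_apply_ne_zero F E a) χ.1 v) (𝓢.omegaLoc v)
          (commute_omegaLoc_localCenter F E c N e JV (JW F E a) hcδ hδ hd hV (isSymm_TW F a) hJV (JW_eq F E a)
            (JW_apply_ne_zero F E a) 𝓢 v)).comp (UnitaryGroup.localLineInl E c N e JV (JW F E a) v)).IsIrreducible]
    [hX' : (show Representation ℂ (UnitaryGroup.localPi E c N JV v) _ from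
        (TwistedCoinv.rep (localCharOfCenter F E c (JW F E a') (JW_apply_ne_zero F E a') χ'.1 v) (𝓢'.omegaLoc v)
          (commute_omegaLoc_localCenter F E c N e JV (JW F E a') hcδ hδ hd hV (isSymm_TW F a') hJV (JW_eq F E a')
            (JW_apply_ne_zero F E a') 𝓢' v)).comp (UnitaryGroup.localLineInl E c N e JV (JW F E a') v)).IsIrreducible] :
    ∃ g : TwistedCoinv.Coinv ((𝓢.omegaLoc v).comp (localCenter E c n (Matrix.reindex e e (JV ⊗ₖ JW F E a)) (JW F E a) (JW_apply_ne_zero F E a) v))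
        (localCharOfCenter F E c (JW F E a) (JW_apply_ne_zero F E a) χ.1 v) →ₛₗ[τ]
        TwistedCoinv.Coinv ((𝓢'.omegaLoc v).comp (localCenter E c n (Matrix.reindex e e (JV ⊗ₖ JW F E a')) (JW F E a') (JW_apply_ne_zero F E a') v))
        (localCharOfCenter F E c (JW F E a') (JW_apply_ne_zero F E a') χ'.1 v),
      Function.Bijective g ∧ ∀ (u : UnitaryGroup.localPi E c N JV v)
        (x : TwistedCoinv.Coinv ((𝓢.omegaLoc v).comp (localCenter E c n (Matrix.reindex e e (JV ⊗ₖ JW F E a)) (JW F E a) (JW_apply_ne_zero F E a) v))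
        (localCharOfCenter F E c (JW F E a) (JW_apply_ne_zero F E a) χ.1 v)),
        g ((show Representation ℂ (UnitaryGroup.localPi E c N JV v) _ from
            (TwistedCoinv.rep (localCharOfCenter F E c (JW F E a) (JW_apply_ne_zero F E a) χ.1 v) (𝓢.omegaLoc v)
              (commute_omegaLoc_localCenter F E c N e JV (JW F E a) hcδ hδ hd hV (isSymm_TW F a) hJV (JW_eq F E a)
                (JW_apply_ne_zero F E a) 𝓢 v)).comp (UnitaryGroup.localLineInl E c N e JV (JW F E a) v)) u x) =
          (show Representation ℂ (UnitaryGroup.localPi E c N JV v) _ from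
            (TwistedCoinv.rep (localCharOfCenter F E c (JW F E a') (JW_apply_ne_zero F E a') χ'.1 v) (𝓢'.omegaLoc v)
              (commute_omegaLoc_localCenter F E c N e JV (JW F E a') hcδ hδ hd hV (isSymm_TW F a') hJV (JW_eq F E a')
                (JW_apply_ne_zero F E a') 𝓢' v)).comp (UnitaryGroup.localLineInl E c N e JV (JW F E a') v)) u (g x) := by
  haveI : NeZero n := ⟨by omega⟩
  exact Literature.RepresentationTheory.Semisimple.exists_semilinear_equivariant_bijective_of_isotypicComponent_eq_top'
    (UnitaryGroup.inclPlace F E c N JV v) hst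
    (isotypicComponent_rhoAtLine_comp_eq_top_of_factors F E c N e JV hcδ hδ hd hV hVd hJV hs a χ 𝓢
      (fun w => UnitaryGroup.localLineInl E c N e JV (JW F E a) w)
      (UnitaryGroup.eventually_localLineInl_mapsTo_localInt E c N e JV (JW F E a)) (MonoidHom.id _) hfac
      (survival_atLine F E c N e JV hcδ hδ hd hV hVd hJV a χ 𝓢) v (UnitaryGroup.inclPlace F E c N JV v) fun g =>
        UnitaryGroup.finAdelicEquiv_finPairEmb_inclPlace E c N e JV (JW F E a) v g)
    (isotypicComponent_rhoAtLine_comp_eq_top_of_factors F E c N e JV hcδ hδ hd hV hVd hJV hs' a' χ' 𝓢'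
      (fun w => UnitaryGroup.localLineInl E c N e JV (JW F E a') w)
      (UnitaryGroup.eventually_localLineInl_mapsTo_localInt E c N e JV (JW F E a')) (MonoidHom.id _) hfac'
      (survival_atLine F E c N e JV hcδ hδ hd hV hVd hJV a' χ' 𝓢') v (UnitaryGroup.inclPlace F E c N JV v) fun g =>
        UnitaryGroup.finAdelicEquiv_finPairEmb_inclPlace E c N e JV (JW F E a') v g)

/-- **THE RESTRICTION STEP of the Galois-twist argument for [Liu2021, Thm. 4.18 (3)]**: a `τ`-semilinear `U(J_V)(𝔸_f)`-equivariant
bijection `rhoAtLine … hs id a χ → rhoAtLine … hs' id a' χ'` of a NON-ZERO carrier yields, at every finite place `v`, a `τ`-semilinear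
`U(J_V)(F_v)`-equivariant bijection of the local types `X_v(𝓢, a, χ) → X_v(𝓢', a', χ')`, the types being irreducible by [Lem. D.1 (1)] AS
PRINTED at both pair data (✔ `isIrreducible_localType_of_lemD1AsPrinted`).  Inputs beyond the data: `hfac ∕ hfac'`, `n ≥ 3`, `hD1 ∕ hD1'`.
[cite: Liu2021, Def. 4.11 (l. 2092–2096), Thm. 4.18 (3) with proof l. 2272–2289, App. D Lem. D.1 (l. 5227; (1) l. 5229); FlathCorvallis1979, Theorem 3 (uniqueness clause); Bump1997, §3.4 Prop. 3.4.1] -/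
theorem exists_semilinear_localTypes_of_semilinearId [RingHomSurjective τ] (hV : TV.IsSymm) (hVd : IsUnit TV.det)
    (hJV : JV = TV.map (algebraMap F E))
    {s : ∀ a : Fˣ, UnitaryGroup.adelicPair F E c N 1 JV (JW F E a) →* adelicMpCont F (Fin n) (adelicGram F e TV (TW F a))}
    (hs : ∀ a : Fˣ, (splittingDatum F E c N 1 e JV (JW F E a) hcδ hδ hd hV (isSymm_TW F a) hVd (isUnit_det_TW F a) hJV
      (JW_eq F E a)).IsCompatible (s a))
    {s' : ∀ a : Fˣ, UnitaryGroup.adelicPair F E c N 1 JV (JW F E a) →* adelicMpCont F (Fin n) (adelicGram F e TV (TW F a))}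
    (hs' : ∀ a : Fˣ, (splittingDatum F E c N 1 e JV (JW F E a) hcδ hδ hd hV (isSymm_TW F a) hVd (isUnit_det_TW F a) hJV
      (JW_eq F E a)).IsCompatible (s' a))
    (a : Fˣ) (χ : Chi F E c)
    (𝓢 : LocalSplitting.FinLocalSplittings F E c n hcδ hδ hd (gram F e TV (TW F a)) (isSymm_gram F e hV (isSymm_TW F a))
      (reindex_kronecker_eq_gram_map F E e hJV (JW_eq F E a)))
    (a' : Fˣ) (χ' : Chi F E c)
    (𝓢' : LocalSplitting.FinLocalSplittings F E c n hcδ hδ hd (gram F e TV (TW F a')) (isSymm_gram F e hV (isSymm_TW F a'))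
      (reindex_kronecker_eq_gram_map F E e hJV (JW_eq F E a')))
    (hfac : (pairSmall₁ F E c N 1 e JV (JW F E a) (s a)).comp (finPairToAdelic F E c N 1 JV (JW F E a)) =
      localRefSection F E c N 1 e JV (JW F E a) hcδ hδ hd hV (isSymm_TW F a) hJV (JW_eq F E a) 𝓢)
    (hfac' : (pairSmall₁ F E c N 1 e JV (JW F E a') (s' a')).comp (finPairToAdelic F E c N 1 JV (JW F E a')) =
      localRefSection F E c N 1 e JV (JW F E a') hcδ hδ hd hV (isSymm_TW F a') hJV (JW_eq F E a') 𝓢')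
    (hn : 3 ≤ n) (μ : ∀ v : HeightOneSpectrum (𝓞 F), (LocalRing E v)ˣ →* ℂˣ) (hμn : ∀ v x, ‖((μ v x : ℂˣ) : ℂ)‖ = 1)
    (hμc : ∀ v, Continuous fun x => ((μ v x : ℂˣ) : ℂ))
    (hμF : ∀ (v : HeightOneSpectrum (𝓞 F)) (t : (v.adicCompletion F)ˣ),
      μ v (Units.map (algebraMap (v.adicCompletion F) (LocalRing E v)).toMonoidHom t) = 1 ↔
        ∃ x : (LocalRing E v)ˣ, (x : LocalRing E v) * conjLocal E c v x =
          algebraMap (v.adicCompletion F) (LocalRing E v) t)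
    (μ' : ∀ v : HeightOneSpectrum (𝓞 F), (LocalRing E v)ˣ →* ℂˣ) (hμn' : ∀ v x, ‖((μ' v x : ℂˣ) : ℂ)‖ = 1)
    (hμc' : ∀ v, Continuous fun x => ((μ' v x : ℂˣ) : ℂ))
    (hμF' : ∀ (v : HeightOneSpectrum (𝓞 F)) (t : (v.adicCompletion F)ˣ),
      μ' v (Units.map (algebraMap (v.adicCompletion F) (LocalRing E v)).toMonoidHom t) = 1 ↔
        ∃ x : (LocalRing E v)ˣ, (x : LocalRing E v) * conjLocal E c v x =
          algebraMap (v.adicCompletion F) (LocalRing E v) t)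
    (hD1 : ∀ v, LemD1_1AsPrinted
      (localLemD1Data F E c N e JV hcδ hδ hd hV hVd hJV a 𝓢 hn μ hμn hμc hμF χ.1
        (norm_chi_eq_one F E c (Algebra.IsQuadraticExtension.finrank_eq_two F E)
          (UnitaryGroup.algEquiv_ne_one_of_apply_eq_neg F E c hcδ hδ) χ) χ.2.1 v))
    (hD1' : ∀ v, LemD1_1AsPrinted
      (localLemD1Data F E c N e JV hcδ hδ hd hV hVd hJV a' 𝓢' hn μ' hμn' hμc' hμF' χ'.1
        (norm_chi_eq_one F E c (Algebra.IsQuadraticExtension.finrank_eq_two F E)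
          (UnitaryGroup.algEquiv_ne_one_of_apply_eq_neg F E c hcδ hδ) χ') χ'.2.1 v))
    [Nontrivial (omegaAtLine F E c N e JV hcδ hδ hd hV hVd hJV hs a χ)]
    (hst : ∃ f : omegaAtLine F E c N e JV hcδ hδ hd hV hVd hJV hs a χ →ₛₗ[τ] omegaAtLine F E c N e JV hcδ hδ hd hV hVd hJV hs' a' χ',
      Function.Bijective f ∧ ∀ (g : UnitaryGroup.finAdelic F E c N JV) (x : omegaAtLine F E c N e JV hcδ hδ hd hV hVd hJV hs a χ),
        f (rhoAtLine F E c N e JV hcδ hδ hd hV hVd hJV hs (MonoidHom.id _) a χ g x) =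
          rhoAtLine F E c N e JV hcδ hδ hd hV hVd hJV hs' (MonoidHom.id _) a' χ' g (f x))
    (v : HeightOneSpectrum (𝓞 F)) :
    ∃ g : TwistedCoinv.Coinv ((𝓢.omegaLoc v).comp (localCenter E c n (Matrix.reindex e e (JV ⊗ₖ JW F E a)) (JW F E a) (JW_apply_ne_zero F E a) v))
        (localCharOfCenter F E c (JW F E a) (JW_apply_ne_zero F E a) χ.1 v) →ₛₗ[τ]
        TwistedCoinv.Coinv ((𝓢'.omegaLoc v).comp (localCenter E c n (Matrix.reindex e e (JV ⊗ₖ JW F E a')) (JW F E a') (JW_apply_ne_zero F E a') v))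
        (localCharOfCenter F E c (JW F E a') (JW_apply_ne_zero F E a') χ'.1 v),
      Function.Bijective g ∧ ∀ (u : UnitaryGroup.localPi E c N JV v)
        (x : TwistedCoinv.Coinv ((𝓢.omegaLoc v).comp (localCenter E c n (Matrix.reindex e e (JV ⊗ₖ JW F E a)) (JW F E a) (JW_apply_ne_zero F E a) v))
        (localCharOfCenter F E c (JW F E a) (JW_apply_ne_zero F E a) χ.1 v)),
        g ((show Representation ℂ (UnitaryGroup.localPi E c N JV v) _ from
            (TwistedCoinv.rep (localCharOfCenter F E c (JW F E a) (JW_apply_ne_zero F E a) χ.1 v) (𝓢.omegaLoc v)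
              (commute_omegaLoc_localCenter F E c N e JV (JW F E a) hcδ hδ hd hV (isSymm_TW F a) hJV (JW_eq F E a)
                (JW_apply_ne_zero F E a) 𝓢 v)).comp (UnitaryGroup.localLineInl E c N e JV (JW F E a) v)) u x) =
          (show Representation ℂ (UnitaryGroup.localPi E c N JV v) _ from
            (TwistedCoinv.rep (localCharOfCenter F E c (JW F E a') (JW_apply_ne_zero F E a') χ'.1 v) (𝓢'.omegaLoc v)
              (commute_omegaLoc_localCenter F E c N e JV (JW F E a') hcδ hδ hd hV (isSymm_TW F a') hJV (JW_eq F E a')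
                (JW_apply_ne_zero F E a') 𝓢' v)).comp (UnitaryGroup.localLineInl E c N e JV (JW F E a') v)) u (g x) := by
  haveI := isIrreducible_localType_of_lemD1AsPrinted F E c N e JV hcδ hδ hd hV hVd hJV a χ 𝓢 hn μ hμn hμc hμF
    (norm_chi_eq_one F E c (Algebra.IsQuadraticExtension.finrank_eq_two F E)
      (UnitaryGroup.algEquiv_ne_one_of_apply_eq_neg F E c hcδ hδ) χ) v (hD1 v)
  haveI := isIrreducible_localType_of_lemD1AsPrinted F E c N e JV hcδ hδ hd hV hVd hJV a' χ' 𝓢' hn μ' hμn' hμc' hμF'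
    (norm_chi_eq_one F E c (Algebra.IsQuadraticExtension.finrank_eq_two F E)
      (UnitaryGroup.algEquiv_ne_one_of_apply_eq_neg F E c hcδ hδ) χ') v (hD1' v)
  exact exists_semilinear_localTypes_of_semilinearId_of_isIrreducible F E c N e JV hcδ hδ hd hV hVd hJV hs hs' a χ 𝓢 a' χ' 𝓢'
    hfac hfac' hn hst v

/-- **THE RESTRICTION STEP, consumer form** (any `ι : G →* U(J_V)(𝔸_f)` ONTO — at the COR-CM face the frame transport `ιVE V`): a
`G`-equivariant `τ`-semilinear bijection `f` between the carriers `ω(s, a, χ) ≠ 0` and `ω(s', a', χ')` — verbatim the shape of the hypothesis of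
row III-11 `Thm418Data.EpsRigidUnderGaloisTwist` read on the tree's carriers — gives, at every finite place `v`, a `τ`-semilinear
`U(J_V)(F_v)`-equivariant bijection of the local types `X_v(𝓢, a, χ) → X_v(𝓢', a', χ')`.
[cite: Liu2021, Def. 4.11 (l. 2092–2096), Thm. 4.18 (3) with proof l. 2272–2289, App. D Lem. D.1 (l. 5227; (1) l. 5229); FlathCorvallis1979, Theorem 3 (uniqueness clause)] -/
theorem exists_semilinear_localTypes_of_semilinear [RingHomSurjective τ] (hV : TV.IsSymm) (hVd : IsUnit TV.det)
    (hJV : JV = TV.map (algebraMap F E))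
    {s : ∀ a : Fˣ, UnitaryGroup.adelicPair F E c N 1 JV (JW F E a) →* adelicMpCont F (Fin n) (adelicGram F e TV (TW F a))}
    (hs : ∀ a : Fˣ, (splittingDatum F E c N 1 e JV (JW F E a) hcδ hδ hd hV (isSymm_TW F a) hVd (isUnit_det_TW F a) hJV
      (JW_eq F E a)).IsCompatible (s a))
    {s' : ∀ a : Fˣ, UnitaryGroup.adelicPair F E c N 1 JV (JW F E a) →* adelicMpCont F (Fin n) (adelicGram F e TV (TW F a))}
    (hs' : ∀ a : Fˣ, (splittingDatum F E c N 1 e JV (JW F E a) hcδ hδ hd hV (isSymm_TW F a) hVd (isUnit_det_TW F a) hJV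
      (JW_eq F E a)).IsCompatible (s' a))
    (a : Fˣ) (χ : Chi F E c)
    (𝓢 : LocalSplitting.FinLocalSplittings F E c n hcδ hδ hd (gram F e TV (TW F a)) (isSymm_gram F e hV (isSymm_TW F a))
      (reindex_kronecker_eq_gram_map F E e hJV (JW_eq F E a)))
    (a' : Fˣ) (χ' : Chi F E c)
    (𝓢' : LocalSplitting.FinLocalSplittings F E c n hcδ hδ hd (gram F e TV (TW F a')) (isSymm_gram F e hV (isSymm_TW F a'))
      (reindex_kronecker_eq_gram_map F E e hJV (JW_eq F E a')))
    (hfac : (pairSmall₁ F E c N 1 e JV (JW F E a) (s a)).comp (finPairToAdelic F E c N 1 JV (JW F E a)) =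
      localRefSection F E c N 1 e JV (JW F E a) hcδ hδ hd hV (isSymm_TW F a) hJV (JW_eq F E a) 𝓢)
    (hfac' : (pairSmall₁ F E c N 1 e JV (JW F E a') (s' a')).comp (finPairToAdelic F E c N 1 JV (JW F E a')) =
      localRefSection F E c N 1 e JV (JW F E a') hcδ hδ hd hV (isSymm_TW F a') hJV (JW_eq F E a') 𝓢')
    (hn : 3 ≤ n) (μ : ∀ v : HeightOneSpectrum (𝓞 F), (LocalRing E v)ˣ →* ℂˣ) (hμn : ∀ v x, ‖((μ v x : ℂˣ) : ℂ)‖ = 1)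
    (hμc : ∀ v, Continuous fun x => ((μ v x : ℂˣ) : ℂ))
    (hμF : ∀ (v : HeightOneSpectrum (𝓞 F)) (t : (v.adicCompletion F)ˣ),
      μ v (Units.map (algebraMap (v.adicCompletion F) (LocalRing E v)).toMonoidHom t) = 1 ↔
        ∃ x : (LocalRing E v)ˣ, (x : LocalRing E v) * conjLocal E c v x =
          algebraMap (v.adicCompletion F) (LocalRing E v) t)
    (μ' : ∀ v : HeightOneSpectrum (𝓞 F), (LocalRing E v)ˣ →* ℂˣ) (hμn' : ∀ v x, ‖((μ' v x : ℂˣ) : ℂ)‖ = 1)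
    (hμc' : ∀ v, Continuous fun x => ((μ' v x : ℂˣ) : ℂ))
    (hμF' : ∀ (v : HeightOneSpectrum (𝓞 F)) (t : (v.adicCompletion F)ˣ),
      μ' v (Units.map (algebraMap (v.adicCompletion F) (LocalRing E v)).toMonoidHom t) = 1 ↔
        ∃ x : (LocalRing E v)ˣ, (x : LocalRing E v) * conjLocal E c v x =
          algebraMap (v.adicCompletion F) (LocalRing E v) t)
    (hD1 : ∀ v, LemD1_1AsPrinted
      (localLemD1Data F E c N e JV hcδ hδ hd hV hVd hJV a 𝓢 hn μ hμn hμc hμF χ.1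
        (norm_chi_eq_one F E c (Algebra.IsQuadraticExtension.finrank_eq_two F E)
          (UnitaryGroup.algEquiv_ne_one_of_apply_eq_neg F E c hcδ hδ) χ) χ.2.1 v))
    (hD1' : ∀ v, LemD1_1AsPrinted
      (localLemD1Data F E c N e JV hcδ hδ hd hV hVd hJV a' 𝓢' hn μ' hμn' hμc' hμF' χ'.1
        (norm_chi_eq_one F E c (Algebra.IsQuadraticExtension.finrank_eq_two F E)
          (UnitaryGroup.algEquiv_ne_one_of_apply_eq_neg F E c hcδ hδ) χ') χ'.2.1 v))
    {G : Type*} [Group G] {ι : G →* UnitaryGroup.finAdelic F E c N JV} (hι : Function.Surjective ι)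
    (hnt : Nontrivial (omegaAtLine F E c N e JV hcδ hδ hd hV hVd hJV hs a χ))
    (hst : ∃ f : omegaAtLine F E c N e JV hcδ hδ hd hV hVd hJV hs a χ →ₛₗ[τ] omegaAtLine F E c N e JV hcδ hδ hd hV hVd hJV hs' a' χ',
      Function.Bijective f ∧ ∀ (g : G) (x : omegaAtLine F E c N e JV hcδ hδ hd hV hVd hJV hs a χ),
        f (rhoAtLine F E c N e JV hcδ hδ hd hV hVd hJV hs ι a χ g x) = rhoAtLine F E c N e JV hcδ hδ hd hV hVd hJV hs' ι a' χ' g (f x))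
    (v : HeightOneSpectrum (𝓞 F)) :
    ∃ g : TwistedCoinv.Coinv ((𝓢.omegaLoc v).comp (localCenter E c n (Matrix.reindex e e (JV ⊗ₖ JW F E a)) (JW F E a) (JW_apply_ne_zero F E a) v))
        (localCharOfCenter F E c (JW F E a) (JW_apply_ne_zero F E a) χ.1 v) →ₛₗ[τ]
        TwistedCoinv.Coinv ((𝓢'.omegaLoc v).comp (localCenter E c n (Matrix.reindex e e (JV ⊗ₖ JW F E a')) (JW F E a') (JW_apply_ne_zero F E a') v))
        (localCharOfCenter F E c (JW F E a') (JW_apply_ne_zero F E a') χ'.1 v),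
      Function.Bijective g ∧ ∀ (u : UnitaryGroup.localPi E c N JV v)
        (x : TwistedCoinv.Coinv ((𝓢.omegaLoc v).comp (localCenter E c n (Matrix.reindex e e (JV ⊗ₖ JW F E a)) (JW F E a) (JW_apply_ne_zero F E a) v))
        (localCharOfCenter F E c (JW F E a) (JW_apply_ne_zero F E a) χ.1 v)),
        g ((show Representation ℂ (UnitaryGroup.localPi E c N JV v) _ from
            (TwistedCoinv.rep (localCharOfCenter F E c (JW F E a) (JW_apply_ne_zero F E a) χ.1 v) (𝓢.omegaLoc v)
              (commute_omegaLoc_localCenter F E c N e JV (JW F E a) hcδ hδ hd hV (isSymm_TW F a) hJV (JW_eq F E a)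
                (JW_apply_ne_zero F E a) 𝓢 v)).comp (UnitaryGroup.localLineInl E c N e JV (JW F E a) v)) u x) =
          (show Representation ℂ (UnitaryGroup.localPi E c N JV v) _ from
            (TwistedCoinv.rep (localCharOfCenter F E c (JW F E a') (JW_apply_ne_zero F E a') χ'.1 v) (𝓢'.omegaLoc v)
              (commute_omegaLoc_localCenter F E c N e JV (JW F E a') hcδ hδ hd hV (isSymm_TW F a') hJV (JW_eq F E a')
                (JW_apply_ne_zero F E a') 𝓢' v)).comp (UnitaryGroup.localLineInl E c N e JV (JW F E a') v)) u (g x) := by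
  haveI := hnt
  exact exists_semilinear_localTypes_of_semilinearId F E c N e JV hcδ hδ hd hV hVd hJV hs hs' a χ 𝓢 a' χ' 𝓢' hfac hfac' hn μ hμn hμc hμF
    μ' hμn' hμc' hμF' hD1 hD1'
    (exists_semilinearId_of_semilinear F E c N e JV hcδ hδ hd hV hVd hJV hs hs' a a' χ χ' hι hst) v

end Literature.NumberTheory.Automorphic.Liu2021.Def411WeilCarriers

end
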